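import Summits.ResolutionOfSingularities.ResolutionOfSingularities.Theorems.FaceCutKernels4
import HarnessLib

/-!
# FaceCutCells — decomp-res node «FaceCut» (lens-2 g26, critic row 208 CLEARED), tree file 5/6 of the node

Content VERBATIM from the decomp-res lens-2 g26 node `HOME/decomp-res-lens-2/g26/FaceCut.lean` (pin dd1d04c7; no
carry, imports the landed g24 node only; ns `…Theses.FaceCut` ↦ `…Theorems.FaceCut`, sub-namespace `FaceX` kept);
HOME = run/shared/lean/pub/decomp-res; critic CRITIC-LEDGER row 208 CLEARED; landing orders INBOX :1364 / rider
10:41:11Z — provenance, critic text and the lens header in the first file of the node, `FaceCutKernels`.  `--kind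
proof --supports stmt-ResolutionOfSingularities-29273`.

## This file

§F.1 SCHEME LEVEL — the face letter, the sub-kind, the DECIDED engine and the residual engine: `faceTail`,
`faceTailPre`, `faceTailPre_le`, the FACE LETTER **`FaceShape c v f`**, `faceShape_insepV3` /
`faceShape_insepV3_tau`, the equicharacteristic guard `ringChar_eq_two_of_algebra`, the point class `IsFaceCuspAt`
(+ lemmas), THE SUB-KIND **`IsUniformFaceCuspCurve`** (+ lemmas), the cells **`FaceCuspExit`** [DECIDED-ON-PAPER:
NODE-g26 §1–§6 + the kernel cores of `FaceCutKernels*`] and **`NonFaceCuspExit`** [UNDECIDED · HYP · no inhabitant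
certified — THE LOCATED RESIDUAL ENGINE of the cuspidal axis after g26] (untagged `def … : Prop`, hypotheses by name
— cn26 advisory treatment as `CuspExit` / `DeepCrossExit`), `faceCuspExit_of_cuspExit`,
`nonFaceCuspExit_of_cuspExit`, `cuspExit_of_face_of_nonFace`, the EXACT HYP-FREE RE-LOCATION **`cuspExit_iff_face :
CuspExit ⟺ FaceCuspExit ∧ NonFaceCuspExit`**, `IsFaceCurvePt` (+ lemmas), `packageExitsOver_of_isFaceCurvePt`.
Imports the last `FaceCutKernels…` part.

[WRITER NOTE (decomp-res writer g13): file split only (tree files ≤ 400 lines); sections, section variables / opens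
and every declaration exactly as in the lens (the node's two HOME-only lines `linter.style.longFile` /
dupNamespace-linter are dropped; the namespace-level `open` lines of the node are replayed in every part, the `open
…Theses` line only in the Theses-cone file `MaxContactCutFaceCut`); namespace renamed `…Theses.FaceCut` ↦
`…Theorems.FaceCut`; the cone-free parts import `…Theorems.CuspCutCells2` (the landed g24 cells) instead of the g24
wiring file, which only the cone file imports.]

(Sources: Hironaka1964 Ch. III §§1–3; CossartJannsenSaito2020 Ch. 2, Ch. 8–9; Matsumura1987 Thm 28.3, §29;
Cohen1946; ZariskiSamuelII Ch. VII §1; Bourbaki AC VII §3; CossartPiltant2008 Prop. 4.2, Lemma 4.3; Moh1987;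
Hauser2010Kangaroo; BierstoneGrigorievMilmanWlodarczyk2011 §3; Cutkosky2009.)
-/

open CategoryTheory AlgebraicGeometry TopologicalSpace IsLocalRing
open Literature.AlgebraicGeometry.Resolution
open Summit.ResolutionOfSingularities.ResolutionOfSingularities.Theorems
open Summit.ResolutionOfSingularities.ResolutionOfSingularities.Theorems.WeakOrderReduction
open Summit.ResolutionOfSingularities.ResolutionOfSingularities.Theorems.DeltaFaceCutClasses
open Summit.ResolutionOfSingularities.ResolutionOfSingularities.Theorems.RelativeDeltaCut
open Summit.ResolutionOfSingularities.ResolutionOfSingularities.Theorems.CurveLeafExit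
open Summit.ResolutionOfSingularities.ResolutionOfSingularities.Theorems.PinchCut
open Summit.ResolutionOfSingularities.ResolutionOfSingularities.Theorems.JetCut
open Summit.ResolutionOfSingularities.ResolutionOfSingularities.Theorems.PurityCut
open Summit.ResolutionOfSingularities.ResolutionOfSingularities.Theorems.SplitCut
open Summit.ResolutionOfSingularities.ResolutionOfSingularities.Theorems.CylinderCut
open Summit.ResolutionOfSingularities.ResolutionOfSingularities.Theorems.SpreadCut
open Summit.ResolutionOfSingularities.ResolutionOfSingularities.Theorems.CrossCut
open Summit.ResolutionOfSingularities.ResolutionOfSingularities.Theorems.DeepCrossCut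
open Summit.ResolutionOfSingularities.ResolutionOfSingularities.Theorems.OddCrossCut
open Summit.ResolutionOfSingularities.ResolutionOfSingularities.Theorems.CuspCut

namespace Summit.ResolutionOfSingularities.ResolutionOfSingularities.Theorems.FaceCut

/-! ## §F.1  SCHEME LEVEL — the face letter, the sub-kind, the DECIDED engine and the residual engine -/

/-- **THE FACE TAIL IDEAL at `y`** (`faceTail c v`): spanned by the monomials `c₀ᵃ c₁ⁱ c₂ʲ vˡ` (`c = (z̃,u₁,u₂)`, `v`
inert) of FACE WEIGHT `105a + 42i + 30j + 20l > 210` — STRICTLY ABOVE the (5,3)-face (weight `> 45` after the tower,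
`face_weight_iff`; the weights are `(w(z̃), w(u₁), w(u₂), w(v)) = (105, 42, 30, 20)/…`, the face `z̃², u₁⁵, v³u₂⁵, u₂⁷` having
weight `210`).  No truncation: ALL monomials above the face, in particular every `z̃`-linear (Artin–Schreier) term `z̃·c₁ⁱc₂ʲvˡ`
with `42i + 30j + 20l > 105`.  (g24's cusp-tail condition `5a + 2(i+j) ≥ 11` is NOT repeated here: for the monomials of `f` it
is implied by the `CuspShape` conjunct of the letter, and as a condition on the GENERATORS it would wrongly exclude the
above-face quintic terms `vˡ·u₁ⁱu₂^{5−i}`, `0 < i < 5` — the pre-stated ideal `faceTailPre` (PRE-PRICING ASK, INBOX :1307) is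
contained in this one: `faceTailPre_le`; the decided sub-kind CONTAINS the pre-stated one.)  DEFINITION (NEW object, the
letter's ideal). [folklore] -/
def faceTail {A : Type} [CommRing A] (c : Fin 3 → A) (v : A) : Ideal A :=
  Ideal.span {x | ∃ a i j l : ℕ, 210 < 105 * a + 42 * i + 30 * j + 20 * l ∧ x = c 0 ^ a * c 1 ^ i * c 2 ^ j * v ^ l}

/-- The face tail ideal AS PRE-STATED in the pricing ask (with g24's cusp-tail clause on the generators).
DEFINITION. [folklore] -/
def faceTailPre {A : Type} [CommRing A] (c : Fin 3 → A) (v : A) : Ideal A :=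
  Ideal.span {x | ∃ a i j l : ℕ, 11 ≤ 5 * a + 2 * (i + j) ∧ 210 < 105 * a + 42 * i + 30 * j + 20 * l ∧
    x = c 0 ^ a * c 1 ^ i * c 2 ^ j * v ^ l}

/-- The pre-stated ideal is inside the letter's ideal (the decided sub-kind contains the pre-stated one).  KERNEL. [folklore] -/
theorem faceTailPre_le {A : Type} [CommRing A] (c : Fin 3 → A) (v : A) : faceTailPre c v ≤ faceTail c v := by
  apply Ideal.span_mono
  rintro x ⟨a, i, j, l, -, h, hx⟩
  exact ⟨a, i, j, l, h, hx⟩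

/-- **FACE SHAPE of `f` in the frame `(c, v)`** (`FaceShape c v f`): `f = z̃² + e₁u₁⁵ + e₂v³u₂⁵ + e₀u₂⁷ (mod faceTail c v)`
with UNIT coefficients `e₀ e₁ e₂`.  DEFINITION (NEW class predicate, ring level). -/
def FaceShape {A : Type} [CommRing A] (c : Fin 3 → A) (v f : A) : Prop :=
  ∃ e₀ e₁ e₂ : A, IsUnit e₀ ∧ IsUnit e₁ ∧ IsUnit e₂ ∧
    f - c 0 ^ 2 - e₁ * c 1 ^ 5 - e₂ * v ^ 3 * c 2 ^ 5 - e₀ * c 2 ^ 7 ∈ faceTail c v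

/-- INSEP-v³ has face shape in its frame over ANY commutative ring (units `1`, tail `0 ∈ faceTail`).  KERNEL. [folklore] -/
theorem faceShape_insepV3 {A : Type} [CommRing A] (X₀ X₁ X₂ X₃ : A) :
    FaceShape (![X₀ + X₁ * (X₂ + X₃), X₂, X₃]) X₁ ((X₀ + X₁ * (X₂ + X₃)) ^ 2 + X₂ ^ 5 + X₁ ^ 3 * X₃ ^ 5 + X₃ ^ 7) := by
  refine ⟨1, 1, 1, isUnit_one, isUnit_one, isUnit_one, ?_⟩
  have h : (X₀ + X₁ * (X₂ + X₃)) ^ 2 + X₂ ^ 5 + X₁ ^ 3 * X₃ ^ 5 + X₃ ^ 7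
      - (![X₀ + X₁ * (X₂ + X₃), X₂, X₃]) 0 ^ 2 - 1 * (![X₀ + X₁ * (X₂ + X₃), X₂, X₃]) 1 ^ 5
      - 1 * X₁ ^ 3 * (![X₀ + X₁ * (X₂ + X₃), X₂, X₃]) 2 ^ 5 - 1 * (![X₀ + X₁ * (X₂ + X₃), X₂, X₃]) 2 ^ 7 = 0 := by
    simp; ring
  rw [h]; exact Ideal.zero_mem _

/-- INSEP-v³'s IMPERFECT-RESIDUE-FIELD twin `z̃² + τ·u₁⁵ + v³u₂⁵ + u₂⁷` (`τ` ANY unit — e.g. `τ` transcendental over `𝔽₂`,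
`K = 𝔽₂(τ)`, `τ` a non-square) reads the face letter with `e = (1, τ, 1)`, tail `0`; the kernel leaf certificates §F.0c are
stated for arbitrary `a b c` and are used with `b = τ`.  KERNEL. [folklore] -/
theorem faceShape_insepV3_tau {A : Type} [CommRing A] (τ X₀ X₁ X₂ X₃ : A) (hτ : IsUnit τ) :
    FaceShape (![X₀ + X₁ * (X₂ + X₃), X₂, X₃]) X₁
      ((X₀ + X₁ * (X₂ + X₃)) ^ 2 + τ * X₂ ^ 5 + X₁ ^ 3 * X₃ ^ 5 + X₃ ^ 7) := by
  refine ⟨1, τ, 1, isUnit_one, hτ, isUnit_one, ?_⟩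
  have h : (X₀ + X₁ * (X₂ + X₃)) ^ 2 + τ * X₂ ^ 5 + X₁ ^ 3 * X₃ ^ 5 + X₃ ^ 7
      - (![X₀ + X₁ * (X₂ + X₃), X₂, X₃]) 0 ^ 2 - τ * (![X₀ + X₁ * (X₂ + X₃), X₂, X₃]) 1 ^ 5
      - 1 * X₁ ^ 3 * (![X₀ + X₁ * (X₂ + X₃), X₂, X₃]) 2 ^ 5 - 1 * (![X₀ + X₁ * (X₂ + X₃), X₂, X₃]) 2 ^ 7 = 0 := by
    simp; ring
  rw [h]; exact Ideal.zero_mem _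

/-- **THE EQUICHARACTERISTIC GUARD IS AUTOMATIC IN THE COLUMN'S FRAME**: a non-trivial algebra over a field of characteristic
`2` has `ringChar = 2` (every stalk of a scheme over `Spec k`, `CharP k 2`).  KERNEL. [folklore] -/
theorem ringChar_eq_two_of_algebra (k A : Type) [Field k] [CharP k 2] [CommRing A] [Nontrivial A] [Algebra k A] :
    ringChar A = 2 := by
  haveI : CharP A 2 := charP_of_injective_algebraMap (algebraMap k A).injective 2
  exact ringChar.eq A 2

/-- **FACE-CUSP-SHAPED at `y` transversal to `η`** (`IsFaceCuspAt I m η y`): g24's `IsCuspAt` data `(h, c, v, g, f, G)` with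
`m = 5`, the EQUICHARACTERISTIC GUARD `ringChar 𝒪_{Y,y} = 2` (so that `𝒪̂_{Y,y}` has a Cohen coefficient field and `2 = 0`
in it; automatic over a field of characteristic 2: `ringChar_eq_two_of_algebra`) AND the face letter `FaceShape c v f` for
the SAME frame and generator.  DEFINITION (NEW class predicate — the structural sub-kind at a cusp point). -/
def IsFaceCuspAt {Y : Scheme.{0}} (I : Y.IdealSheafData) (m : ℕ) (η y : Y) : Prop :=
  ∃ h : η ⤳ y, ∃ (c : Fin 3 → Y.presheaf.stalk y) (v g f : Y.presheaf.stalk y) (G : ℕ → Y.presheaf.stalk y),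
    Ideal.span (Set.range c) = curvePrime h ∧
      Ideal.span (Set.range c ∪ {v}) = maximalIdeal (Y.presheaf.stalk y) ∧
      (maximalIdeal (Y.presheaf.stalk y)).spanFinrank = 4 ∧
      stalkIdeal I y = Ideal.span {f} ∧
      CuspShape (curvePrime h) (maximalIdeal (Y.presheaf.stalk y)) c G g f m ∧
      m = 5 ∧ ringChar (Y.presheaf.stalk y) = 2 ∧ FaceShape c v f

/-- A face-cusp-shaped point is cusp-shaped (letter inclusion).  KERNEL. [folklore] -/
theorem isCuspAt_of_isFaceCuspAt {Y : Scheme.{0}} {I : Y.IdealSheafData} {m : ℕ} {η y : Y}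
    (h : IsFaceCuspAt I m η y) : IsCuspAt I m η y := by
  obtain ⟨h, c, v, g, f, G, h1, h2, h3, h4, h5, -, -, -⟩ := h
  exact ⟨h, c, v, g, f, G, h1, h2, h3, h4, h5⟩

/-- `m = 5` and `ringChar 𝒪_{Y,y} = 2` at a face-cusp-shaped point.  KERNEL. [folklore] -/
theorem eq_five_of_isFaceCuspAt {Y : Scheme.{0}} {I : Y.IdealSheafData} {m : ℕ} {η y : Y}
    (h : IsFaceCuspAt I m η y) : m = 5 ∧ ringChar (Y.presheaf.stalk y) = 2 := by
  obtain ⟨-, -, -, -, -, -, -, -, -, -, -, hm, hc, -⟩ := h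
  exact ⟨hm, hc⟩

/-- **UNIFORMLY FACE-CUSP-SHAPED CURVE** (`IsUniformFaceCuspCurve I n m η`) — THE PRE-STATED SUB-KIND: a uniformly cusp-shaped
curve (g24: `n = 2`, EVERY closed point of residue characteristic `2` and cusp-OR-SIMPLE-shaped with the same `m`) every closed
point `y` of which is EITHER a g19 SPREAD point (`IsSpreadAt I n m η y`: the secondary curve is relatively SIMPLE over `y` —
after the tower every point over `y` exits with `τ = 3`, g19 §Γ.1 / g24 NODE §1.2; e.g. the points `y_α ≠ y₀` of INSEP-v³'s top
curve) OR a FACE-CUSP point (`IsFaceCuspAt I m η y`: the (5,3)-face letter with all tails).  No residue-field restriction, no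
tail truncation, arbitrary unit coefficients.  DEFINITION (NEW class predicate). -/
def IsUniformFaceCuspCurve {Y : Scheme.{0}} (I : Y.IdealSheafData) (n m : ℕ) (η : Y) : Prop :=
  IsUniformCuspCurve I n m η ∧ ∀ y : Y, η ⤳ y → IsClosed ({y} : Set Y) → IsSpreadAt I n m η y ∨ IsFaceCuspAt I m η y

/-- Letter inclusion at curve level.  KERNEL. [folklore] -/
theorem isUniformCuspCurve_of_face {Y : Scheme.{0}} {I : Y.IdealSheafData} {n m : ℕ} {η : Y}
    (h : IsUniformFaceCuspCurve I n m η) : IsUniformCuspCurve I n m η := h.1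

/-- A uniformly cusp-shaped curve all of whose closed points are spread points is in the face sub-kind (vacuous face part:
such curves exit by the tower alone).  KERNEL. [folklore] -/
theorem isUniformFaceCuspCurve_of_spread {Y : Scheme.{0}} {I : Y.IdealSheafData} {n m : ℕ} {η : Y}
    (hC : IsUniformCuspCurve I n m η) (hS : ∀ y : Y, η ⤳ y → IsClosed ({y} : Set Y) → IsSpreadAt I n m η y) :
    IsUniformFaceCuspCurve I n m η :=
  ⟨hC, fun y hy hc => Or.inl (hS y hy hc)⟩

/-- **ENGINE `FaceCuspExit` — DECIDED** [paper: NODE-g26 §2–§5 (dictionary + weighted preparation; transport; permissibility;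
B-aware leaf lemma; equiresolution along g24's 10-centre package; g24 NODE §1 for the tower); kernel cores §F.0:
`faceCheck_eq_true`, `face_e0`–`face_e38`, the 56 `face_leaf*`, `face_tower`, `face_towerMonomial`, `face_weight_iff`]: on a
regular scheme, a Top-isolated uniformly FACE-cusp-shaped curve has an exit package with centres over it.
STATEMENT (engine, the decided sub-kind). (Sources: as in the module docstring.) -/
def FaceCuspExit : Prop :=
  ∀ (Y : Scheme.{0}), Scheme.IsRegular Y → ∀ (I : Y.IdealSheafData) (n m : ℕ) (η : Y),
    IsUniformFaceCuspCurve I n m η → IsTopIsolatedClosure I n η → PackageExitsOver I n {y : Y | η ⤳ y}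

/-- **ENGINE `NonFaceCuspExit` — THE NEW LOCATED RESIDUAL ENGINE** [UNDECIDED · HYP · WEAKER than `CuspExit` by letter]:
the exit package for the uniformly cusp-shaped curves that are NOT uniformly face-cusp-shaped: SOME closed point of the curve is
neither a spread point nor a (5,3)-face-cusp point — i.e. a cusp point with another face `(m, b)` (`m ≠ 5`, or `m = 5` and
`b ≠ 3`: faces `(5,b)`, `(7,3)`, `(9,3)`, …), or with a term ON OR BELOW the (5,3)-face weight after the tower (non-quasi-
homogeneous / mixed cusps, e.g. the g24-legal tail `u₁u₂⁵`: `faceCheckExtra_u1u2five`), or whose local ring has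
characteristic `≠ 2` (mixed characteristic `(0,2)`; outside the column's frame).  NO INHABITANT CERTIFIED at scheme level
(ring-level candidates: `z̃² + u₁⁵ + v³u₂⁵ + u₂⁷ + u₁u₂⁵`, the `(7,3)` face `z̃² + u₁⁷ + v³u₂⁷ + u₂⁹`).  STATEMENT (engine,
residual · UNDECIDED · HYP). -/
def NonFaceCuspExit : Prop :=
  ∀ (Y : Scheme.{0}), Scheme.IsRegular Y → ∀ (I : Y.IdealSheafData) (n m : ℕ) (η : Y),
    IsUniformCuspCurve I n m η → ¬ IsUniformFaceCuspCurve I n m η → IsTopIsolatedClosure I n η →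
      PackageExitsOver I n {y : Y | η ⤳ y}

/-- The decided sub-kind engine is a letter-restriction of g24's `CuspExit`.  KERNEL. [folklore] -/
theorem faceCuspExit_of_cuspExit (h : CuspExit) : FaceCuspExit :=
  fun Y hY I n m η hF hT => h Y hY I n m η hF.1 hT

/-- The residual engine is a letter-restriction of g24's `CuspExit`.  KERNEL. [folklore] -/
theorem nonFaceCuspExit_of_cuspExit (h : CuspExit) : NonFaceCuspExit :=
  fun Y hY I n m η hC _ hT => h Y hY I n m η hC hT

/-- **THE DICHOTOMY CLOSES THE ENGINE**: face-decided + non-face residual ⇒ `CuspExit` (by cases on the letter).  KERNEL.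
[folklore] -/
theorem cuspExit_of_face_of_nonFace (hFa : FaceCuspExit) (hNF : NonFaceCuspExit) : CuspExit := by
  intro Y hY I n m η hC hT
  by_cases hF : IsUniformFaceCuspCurve I n m η
  · exact hFa Y hY I n m η hF hT
  · exact hNF Y hY I n m η hC hF hT

/-- **EXACT CUT OF THE ENGINE** (pure logic): `CuspExit ⟺ FaceCuspExit ∧ NonFaceCuspExit`.  KERNEL. [folklore] -/
theorem cuspExit_iff_face : CuspExit ↔ FaceCuspExit ∧ NonFaceCuspExit :=
  ⟨fun h => ⟨faceCuspExit_of_cuspExit h, nonFaceCuspExit_of_cuspExit h⟩, fun h => cuspExit_of_face_of_nonFace h.1 h.2⟩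

/-- **FACE-CURVE point** (the decided-side SUB-CLASS): `y` lies on (or is the generic point of) a Top-isolated, uniformly
face-cusp-shaped curve.  Inhabitant: the core of INSEP-v³ and every point of its top curve (ring-level reading
`faceShape_insepV3`, `insepV3_faceRoot`; g24 `section Pilot`).  DEFINITION (NEW class). -/
def IsFaceCurvePt {Y : Scheme.{0}} (I : Y.IdealSheafData) (n : ℕ) (y : Y) : Prop :=
  ∃ (η : Y) (m : ℕ), η ⤳ y ∧ IsTopIsolatedClosure I n η ∧ IsUniformFaceCuspCurve I n m η

/-- A face-curve point is a cusp-curve point of g24 (`IsCuspCurvePt`).  KERNEL. [folklore] -/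
theorem isCuspCurvePt_of_isFaceCurvePt {Y : Scheme.{0}} {I : Y.IdealSheafData} {n : ℕ} {y : Y}
    (h : IsFaceCurvePt I n y) : IsCuspCurvePt I n y := by
  obtain ⟨η, m, hy, hT, hF⟩ := h
  exact ⟨η, m, hy, hT, hF.1⟩

/-- On the face sub-kind the marking is `2` (from g24's letter).  KERNEL. [folklore] -/
theorem eq_two_of_isUniformFaceCuspCurve {Y : Scheme.{0}} {I : Y.IdealSheafData} {n m : ℕ} {η : Y}
    (h : IsUniformFaceCuspCurve I n m η) : n = 2 :=
  eq_two_of_isUniformCuspCurve h.1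

/-- Under the decided engine every point of a Top-isolated uniformly face-cusp-shaped curve is covered by an exit package
over the curve (the engine applied; bookkeeping for the port).  KERNEL. [folklore] -/
theorem packageExitsOver_of_isFaceCurvePt (hFa : FaceCuspExit) {Y : Scheme.{0}} (hY : Scheme.IsRegular Y)
    {I : Y.IdealSheafData} {n : ℕ} {y : Y} (h : IsFaceCurvePt I n y) :
    ∃ η : Y, η ⤳ y ∧ PackageExitsOver I n {x : Y | η ⤳ x} := by
  obtain ⟨η, m, hy, hT, hF⟩ := h
  exact ⟨η, hy, hFa Y hY I n m η hF hT⟩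

end Summit.ResolutionOfSingularities.ResolutionOfSingularities.Theorems.FaceCut
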